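import Summits.CriticalPhenomena.PercolationContinuityZ3.Theorems.PercNearOneGluingNoHeavyLowerTailThreePointPiecesParallel
import Summits.CriticalPhenomena.PercolationContinuityZ3.Theorems.PercNearOneGluingNoHeavyLowerTailThreePointPiecesSeries
import HarnessLib

/-!
# `(3PT)` for parallel compositions of hubs and series pieces, all weights

Support file for crux `stmt-CriticalPhenomena-4575` (`NoHeavyLowerTail`), seat `prim-l12-p1` gen 20 (`--supports stmt-CriticalPhenomena-4575`);
continuation of `…ThreePointPieces.lean`, `…ThreePointPiecesParallel.lean` (`threePointVariance_of_pieces`: `(K)` per piece ⟹ `(3PT)`)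
and `…ThreePointPiecesSeries.lean` (`real_series`).  Memo `run/shared/lean/prim/prim-l12/FROM-prim-l12-p1-g20-*.md`.

[this work]:
* `isoK_hub`: a single-hub piece satisfies `(K)` — its piece events ARE the single-hub events `isoH` of Theorem H
  (`pieceConn_hub_iff`, `isoPiece_hub_eq`), so gen 19's identities `star_isoK_*` apply;
* `isoK_series`: a series piece (middle terminal `c`, `a` or `b`) satisfies `(K)` — from `P(middle isolated) = P(separated)` and
  `P(separated) = P(side) · P(side)` (`real_series`) by the algebra `isoK_of_series_eqs`;
* `threePointVariance_of_hubs_and_series`: **the three-point variance row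
  `P(a↔b)·P(a↮b) ≤ P(a↔b, a↮c) + P(a↔c, a↮b) + P(b↔c, a↮b)` holds, for all weights, on every graph glued at `{a,b,c}` from
  single hubs and series pieces** (no edges between different pieces; terminal–terminal edges arbitrary).  This is the
  `∥`-closed class generated by `K_{1,3}`-stars, two-terminal networks and terminal-cut-vertex pieces; it contains Theorem H
  (`threePointVariance_hubGraph`, all hub graphs) and the cut-vertex classes of gens 16–18, and is the first proved class for `(3PT)`
  with pieces of unbounded internal structure glued in parallel.  `(K)` fails for some two-hub pieces (by `6·10⁻⁵`, memo gen 19 §7),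
  so further pieces need either a finer criterion or a different argument.
-/

namespace Summit.CriticalPhenomena.PercolationContinuityZ3.Theorems.ThreePointPieces

open MeasureTheory Set
open Literature.Probability.Percolation Literature.Probability.LatticeModels

variable {V : Type*} [Fintype V] [DecidableEq V] {ι : Type*} [DecidableEq ι]

/-! ## Pieces that satisfy `(K)`: single hubs -/

section hub
variable (w : Sym2 V → unitInterval) {a b c : V} (part : V → ι) {i : ι} {h : V}

/-- **Piece reachability through a single hub**: if piece `i` is the single non-terminal `h`, then for distinct terminals `x, y`,
`x` reaches `y` inside the piece iff `s(x,h)` and `s(y,h)` are open. [this work] -/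
theorem pieceConn_hub_iff (hh : h ∉ terms a b c) (hhi : part h = i) (hi : ∀ v, v ∉ terms a b c → part v = i → v = h)
    {x y : V} (hx : x ∈ terms a b c) (hy : y ∈ terms a b c) (hxy : x ≠ y) {ω : BondConfig V} :
    ω ∈ pieceConn (piecePairs a b c part i) x y ↔ s(x, h) ∈ ω ∧ s(y, h) ∈ ω := by
  have hxh : x ≠ h := fun e => hh (e ▸ hx)
  have hyh : y ≠ h := fun e => hh (e ▸ hy)
  constructor
  · rintro ⟨p⟩
    -- closure of `R = {x} ∪ {v : s(x,h) open ∧ (v = h ∨ s(v,h) open)}` under adjacency in the piece graph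
    set R : Set V := {v | v = x ∨ (s(x, h) ∈ ω ∧ (v = h ∨ s(v, h) ∈ ω))} with hR
    have hcl : ∀ u v, (openGraph (ω ∩ ↑(piecePairs a b c part i))).Adj u v → u ∈ R → v ∈ R := by
      intro u v huv hu
      rw [openGraph_adj] at huv
      obtain ⟨⟨he, heF⟩, hne⟩ := huv
      obtain ⟨hu1, hv1, huv1⟩ := mem_piecePairs_mk (Finset.mem_coe.1 heF)
      -- one endpoint is `h`
      rcases huv1 with ⟨huT, hui⟩ | ⟨hvT, hvi⟩
      · -- `u = h`, so `v` is a terminal with `s(v,h)` open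
        have hu' : u = h := hi u huT hui
        subst hu'
        rcases hu with hux | ⟨hxo, _⟩
        · exact (hxh hux.symm).elim
        · refine Or.inr ⟨hxo, Or.inr ?_⟩
          rw [Sym2.eq_swap]; exact he
      · -- `v = h`
        have hv' : v = h := hi v hvT hvi
        subst hv'
        rcases hu with rfl | ⟨hxo, _⟩
        · exact Or.inr ⟨he, Or.inl rfl⟩
        · exact Or.inr ⟨hxo, Or.inl rfl⟩
    have hstay : ∀ {u v : V} (_ : (openGraph (ω ∩ ↑(piecePairs a b c part i))).Walk u v), u ∈ R → v ∈ R := by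
      intro u v q
      induction q with
      | nil => exact id
      | cons h' _ ih => exact fun hu => ih (hcl _ _ h' hu)
    have hyR := hstay p (Or.inl rfl)
    rcases hyR with hyx | ⟨hxo, hyh' | hyo⟩
    · exact (hxy hyx.symm).elim
    · exact (hyh hyh').elim
    · exact ⟨hxo, hyo⟩
  · rintro ⟨h1, h2⟩
    have e1 : (openGraph (ω ∩ ↑(piecePairs a b c part i))).Adj x h := by
      rw [openGraph_adj]
      refine ⟨⟨h1, Finset.mem_coe.2 ?_⟩, hxh⟩
      rw [Sym2.eq_swap]; exact mk_mem_piecePairs hh hhi (Or.inr hx) (Ne.symm hxh)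
    have e2 : (openGraph (ω ∩ ↑(piecePairs a b c part i))).Adj h y := by
      rw [openGraph_adj]
      refine ⟨⟨?_, Finset.mem_coe.2 (mk_mem_piecePairs hh hhi (Or.inr hy) (Ne.symm hyh))⟩, Ne.symm hyh⟩
      rw [Sym2.eq_swap]; exact h2
    exact e1.reachable.trans e2.reachable

/-- For a single-hub piece, `isoPiece x y z = isoH x y z h` (the single-hub event of Theorem H). [this work] -/
theorem isoPiece_hub_eq (hh : h ∉ terms a b c) (hhi : part h = i) (hi : ∀ v, v ∉ terms a b c → part v = i → v = h)
    {x y z : V} (hx : x ∈ terms a b c) (hy : y ∈ terms a b c) (hz : z ∈ terms a b c) (hxy : x ≠ y) (hxz : x ≠ z) :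
    isoPiece (piecePairs a b c part i) x y z = ThreePointHubEvents.isoH x y z h := by
  ext ω
  simp only [isoPiece, ThreePointHubEvents.isoH, mem_inter_iff, mem_compl_iff, mem_setOf_eq,
    pieceConn_hub_iff part hh hhi hi hx hy hxy, pieceConn_hub_iff part hh hhi hi hx hz hxz]
  tauto

/-- **A single-hub piece satisfies `(K)`** (in the form used by `threePointVariance_of_pieces`). [this work] -/
theorem isoK_hub (hab : a ≠ b) (hac : a ≠ c) (hbc : b ≠ c) (hh : h ∉ terms a b c) (hhi : part h = i)
    (hi : ∀ v, v ∉ terms a b c → part v = i → v = h) :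
    let F := piecePairs a b c part i
    (prodBernoulli w).real (isoPiece F a b c ∩ isoPiece F b a c) ^ 3 ≤
        (prodBernoulli w).real (isoPiece F c a b) ^ 2 * (prodBernoulli w).real (isoPiece F b a c) *
          (prodBernoulli w).real (isoPiece F a b c) ∧
      (prodBernoulli w).real (isoPiece F a b c ∩ isoPiece F b a c) ^ 3 ≤
        (prodBernoulli w).real (isoPiece F c a b) * (prodBernoulli w).real (isoPiece F b a c) ^ 2 *
          (prodBernoulli w).real (isoPiece F a b c) ∧
      (prodBernoulli w).real (isoPiece F a b c ∩ isoPiece F b a c) ^ 3 ≤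
        (prodBernoulli w).real (isoPiece F c a b) * (prodBernoulli w).real (isoPiece F b a c) *
          (prodBernoulli w).real (isoPiece F a b c) ^ 2 := by
  intro F
  have ha : a ∈ terms a b c := mem_terms.2 (Or.inl rfl)
  have hb : b ∈ terms a b c := mem_terms.2 (Or.inr (Or.inl rfl))
  have hc : c ∈ terms a b c := mem_terms.2 (Or.inr (Or.inr rfl))
  have eA : isoPiece F a b c = ThreePointHubEvents.isoH a b c h := isoPiece_hub_eq part hh hhi hi ha hb hc hab hac
  have eB : isoPiece F b a c = ThreePointHubEvents.isoH b a c h := isoPiece_hub_eq part hh hhi hi hb ha hc (Ne.symm hab) hbc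
  have eC : isoPiece F c a b = ThreePointHubEvents.isoH c a b h := isoPiece_hub_eq part hh hhi hi hc ha hb (Ne.symm hac) (Ne.symm hbc)
  set α : ℝ := (w s(a, h) : ℝ)
  set β : ℝ := (w s(b, h) : ℝ)
  set γ : ℝ := (w s(c, h) : ℝ)
  have h01 : 0 ≤ α ∧ α ≤ 1 ∧ 0 ≤ β ∧ β ≤ 1 ∧ 0 ≤ γ ∧ γ ≤ 1 :=
    ⟨unitInterval.nonneg _, unitInterval.le_one _, unitInterval.nonneg _, unitInterval.le_one _, unitInterval.nonneg _,
      unitInterval.le_one _⟩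
  obtain ⟨h1, h2, h3, h4, h5, h6⟩ := h01
  have rQ : (prodBernoulli w).real (isoPiece F a b c ∩ isoPiece F b a c) = 1 - α * β - α * γ - β * γ + 2 * α * β * γ := by
    rw [eA, eB, ThreePointHubEvents.real_sepH w hab hac hbc]
  have rC : (prodBernoulli w).real (isoPiece F a b c) = 1 - α * (β + γ - β * γ) := by
    rw [eA, ThreePointHubEvents.real_isoH w hab hac hbc]; ring
  have rB : (prodBernoulli w).real (isoPiece F b a c) = 1 - β * (α + γ - α * γ) := by
    rw [eB, ThreePointHubEvents.real_isoH w (Ne.symm hab) hbc hac]; ring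
  have rA : (prodBernoulli w).real (isoPiece F c a b) = 1 - γ * (α + β - α * β) := by
    rw [eC, ThreePointHubEvents.real_isoH w (Ne.symm hac) (Ne.symm hbc) hab]; ring
  rw [rQ, rA, rB, rC]
  exact ⟨ThreePointIsoProduct.star_isoK_A h1 h2 h3 h4 h5 h6, ThreePointIsoProduct.star_isoK_B h1 h2 h3 h4 h5 h6,
    ThreePointIsoProduct.star_isoK_C h1 h2 h3 h4 h5 h6⟩

end hub

/-! ## `(K)` for series pieces, in the orientation of `threePointVariance_of_pieces` -/

section seriesK
variable (w : Sym2 V → unitInterval) {a b c : V} (part : V → ι) (i : ι)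

omit [Fintype V] [DecidableEq V] [DecidableEq ι] in
/-- `isoPiece` is symmetric in its last two arguments. [this work] -/
theorem isoPiece_swap (F : Finset (Sym2 V)) (x y z : V) : isoPiece F x y z = isoPiece F x z y := Set.inter_comm _ _

omit [Fintype V] [DecidableEq V] [DecidableEq ι] in
/-- Two of the three pairwise "isolated inside" events already give the separated event. [this work] -/
theorem isoPiece_inter_eq (F : Finset (Sym2 V)) (x y z : V) :
    isoPiece F y x z ∩ isoPiece F z x y = isoPiece F x y z ∩ isoPiece F y x z := by
  ext ω
  simp only [isoPiece, pieceConn, mem_inter_iff, mem_compl_iff, mem_setOf_eq]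
  constructor
  · rintro ⟨⟨h1, h2⟩, h3, -⟩
    exact ⟨⟨fun h => h1 (SimpleGraph.Reachable.symm h), fun h => h3 (SimpleGraph.Reachable.symm h)⟩, h1, h2⟩
  · rintro ⟨⟨h1, h2⟩, -, h4⟩
    exact ⟨⟨fun h => h1 (SimpleGraph.Reachable.symm h), h4⟩, fun h => h2 (SimpleGraph.Reachable.symm h),
      fun h => h4 (SimpleGraph.Reachable.symm h)⟩

/-- The algebra: `(K)` from "middle isolation = separation" and "separation = product of the two sides". [this work] -/
theorem isoK_of_series_eqs {Q A B C : ℝ} (hQ : 0 ≤ Q) (hQA : Q ≤ A) (hQB : Q ≤ B) (hQC : Q ≤ C)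
    (h : (A = Q ∧ Q = C * B) ∨ (B = Q ∧ Q = C * A) ∨ (C = Q ∧ Q = B * A)) :
    Q ^ 3 ≤ A ^ 2 * B * C ∧ Q ^ 3 ≤ A * B ^ 2 * C ∧ Q ^ 3 ≤ A * B * C ^ 2 := by
  have hQ2 : 0 ≤ Q ^ 2 := sq_nonneg Q
  rcases h with ⟨hA, hP⟩ | ⟨hB, hP⟩ | ⟨hC, hP⟩
  · subst hA
    refine ⟨?_, ?_, ?_⟩
    · nlinarith [hP]
    · have e : A * B ^ 2 * C = B * A ^ 2 := by rw [hP]; ring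
      rw [e]; nlinarith [mul_le_mul_of_nonneg_left hQB hQ2]
    · have e : A * B * C ^ 2 = C * A ^ 2 := by rw [hP]; ring
      rw [e]; nlinarith [mul_le_mul_of_nonneg_left hQC hQ2]
  · subst hB
    refine ⟨?_, ?_, ?_⟩
    · have e : A ^ 2 * B * C = A * B ^ 2 := by rw [hP]; ring
      rw [e]; nlinarith [mul_le_mul_of_nonneg_left hQA hQ2]
    · nlinarith [hP]
    · have e : A * B * C ^ 2 = C * B ^ 2 := by rw [hP]; ring
      rw [e]; nlinarith [mul_le_mul_of_nonneg_left hQC hQ2]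
  · subst hC
    refine ⟨?_, ?_, ?_⟩
    · have e : A ^ 2 * B * C = A * C ^ 2 := by rw [hP]; ring
      rw [e]; nlinarith [mul_le_mul_of_nonneg_left hQA hQ2]
    · have e : A * B ^ 2 * C = B * C ^ 2 := by rw [hP]; ring
      rw [e]; nlinarith [mul_le_mul_of_nonneg_left hQB hQ2]
    · nlinarith [hP]

/-- **`(K)` for a series piece**, middle terminal `c`, `a` or `b` (the three admissible orientations), in the form used by
`threePointVariance_of_pieces`. [this work] -/
theorem isoK_series (hab : a ≠ b) (hac : a ≠ c) (hbc : b ≠ c) (X : Finset V)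
    (hsep : (∀ u v : V, (u = a ∨ (u ∉ terms a b c ∧ part u = i ∧ u ∈ X)) → (v = b ∨ (v ∉ terms a b c ∧ part v = i ∧ v ∉ X)) →
        ((u ∉ terms a b c ∧ part u = i ∧ u ∈ X) ∨ (v ∉ terms a b c ∧ part v = i ∧ v ∉ X)) → (w s(u, v) : ℝ) = 0) ∨
      (∀ u v : V, (u = b ∨ (u ∉ terms a b c ∧ part u = i ∧ u ∈ X)) → (v = c ∨ (v ∉ terms a b c ∧ part v = i ∧ v ∉ X)) →
        ((u ∉ terms a b c ∧ part u = i ∧ u ∈ X) ∨ (v ∉ terms a b c ∧ part v = i ∧ v ∉ X)) → (w s(u, v) : ℝ) = 0) ∨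
      (∀ u v : V, (u = a ∨ (u ∉ terms a b c ∧ part u = i ∧ u ∈ X)) → (v = c ∨ (v ∉ terms a b c ∧ part v = i ∧ v ∉ X)) →
        ((u ∉ terms a b c ∧ part u = i ∧ u ∈ X) ∨ (v ∉ terms a b c ∧ part v = i ∧ v ∉ X)) → (w s(u, v) : ℝ) = 0)) :
    let F := piecePairs a b c part i
    (prodBernoulli w).real (isoPiece F a b c ∩ isoPiece F b a c) ^ 3 ≤
        (prodBernoulli w).real (isoPiece F c a b) ^ 2 * (prodBernoulli w).real (isoPiece F b a c) *
          (prodBernoulli w).real (isoPiece F a b c) ∧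
      (prodBernoulli w).real (isoPiece F a b c ∩ isoPiece F b a c) ^ 3 ≤
        (prodBernoulli w).real (isoPiece F c a b) * (prodBernoulli w).real (isoPiece F b a c) ^ 2 *
          (prodBernoulli w).real (isoPiece F a b c) ∧
      (prodBernoulli w).real (isoPiece F a b c ∩ isoPiece F b a c) ^ 3 ≤
        (prodBernoulli w).real (isoPiece F c a b) * (prodBernoulli w).real (isoPiece F b a c) *
          (prodBernoulli w).real (isoPiece F a b c) ^ 2 := by
  intro F
  have ha : a ∈ terms a b c := mem_terms.2 (Or.inl rfl)
  have hb : b ∈ terms a b c := mem_terms.2 (Or.inr (Or.inl rfl))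
  have hc : c ∈ terms a b c := mem_terms.2 (Or.inr (Or.inr rfl))
  have hQA : (prodBernoulli w).real (isoPiece F a b c ∩ isoPiece F b a c) ≤ (prodBernoulli w).real (isoPiece F c a b) :=
    measureReal_mono fun ω ⟨h1, h2⟩ => ⟨fun h => h1.2 (SimpleGraph.Reachable.symm h), fun h => h2.2 (SimpleGraph.Reachable.symm h)⟩
  have hQB : (prodBernoulli w).real (isoPiece F a b c ∩ isoPiece F b a c) ≤ (prodBernoulli w).real (isoPiece F b a c) :=
    measureReal_mono fun ω ⟨_, h2⟩ => h2
  have hQC : (prodBernoulli w).real (isoPiece F a b c ∩ isoPiece F b a c) ≤ (prodBernoulli w).real (isoPiece F a b c) :=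
    measureReal_mono fun ω ⟨h1, _⟩ => h1
  refine isoK_of_series_eqs measureReal_nonneg hQA hQB hQC ?_
  rcases hsep with h | h | h
  · -- middle `c`
    have hT : ∀ v, v ∈ terms a b c → v = a ∨ v = b ∨ v = c := fun v hv => mem_terms.1 hv
    obtain ⟨h1, h2⟩ := real_series w (part := part) (i := i) (X := X) hT ha hb hc hab hac hbc h
    exact Or.inl ⟨h1, h2⟩
  · -- middle `a`
    have hT : ∀ v, v ∈ terms a b c → v = b ∨ v = c ∨ v = a := fun v hv => by rw [mem_terms] at hv; tauto
    obtain ⟨h1, h2⟩ := real_series w (part := part) (i := i) (X := X) hT hb hc ha hbc (Ne.symm hab) (Ne.symm hac) h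
    have e1 : isoPiece F b c a = isoPiece F b a c := isoPiece_swap F b c a
    have e2 : isoPiece F c b a = isoPiece F c a b := isoPiece_swap F c b a
    rw [e1, e2, isoPiece_inter_eq F a b c] at h1 h2
    exact Or.inr (Or.inr ⟨h1, by rw [h2, mul_comm]⟩)
  · -- middle `b`
    have hT : ∀ v, v ∈ terms a b c → v = a ∨ v = c ∨ v = b := fun v hv => by rw [mem_terms] at hv; tauto
    obtain ⟨h1, h2⟩ := real_series w (part := part) (i := i) (X := X) hT ha hc hb hac hab (Ne.symm hbc) h
    have e1 : isoPiece F a c b = isoPiece F a b c := isoPiece_swap F a c b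
    have e2 : isoPiece F c a b ∩ isoPiece F a b c = isoPiece F a b c ∩ isoPiece F b a c := by
      rw [Set.inter_comm]
      have h' := isoPiece_inter_eq F b a c
      rw [isoPiece_swap F c b a] at h'
      rw [h', Set.inter_comm]
    rw [e1] at h1 h2
    rw [Set.inter_comm, e2] at h1 h2
    exact Or.inr (Or.inl ⟨h1, by rw [h2, mul_comm]⟩)

end seriesK

/-! ## `(3PT)` for parallel compositions of hubs and series pieces -/

/-- **The three-point variance row for every parallel composition of hubs and series pieces, all weights.**
Let `part : V → ι` label the vertices of a finite weighted graph with pairwise distinct terminals `a b c`, such that non-terminal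
vertices with different labels are never joined, and suppose every piece is EITHER a single hub (one non-terminal vertex, joined
to the terminals arbitrarily) OR a series piece: its non-terminals split into a side `X` and the rest so that — for one choice of
the "middle" terminal among `c, a, b` — no pair joins `{x} ∪ X` to `{y} ∪ rest` other than possibly the terminal pair `xy` itself
(`x, y` the two non-middle terminals; e.g. any two-terminal network between two of the terminals, any chain
`x — network — z — network — y`, the empty piece).  Terminal–terminal pairs carry arbitrary weights.  Then
`P(a↔b)·P(a↮b) ≤ P(a↔b, a↮c) + P(a↔c, a↮b) + P(b↔c, a↮b)`.
This contains Theorem H (`threePointVariance_hubGraph`: every piece a hub) and the cut-vertex classes of gens 16–18. [this work] -/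
theorem threePointVariance_of_hubs_and_series [Fintype ι] (w : Sym2 V → unitInterval) {a b c : V} (hab : a ≠ b) (hac : a ≠ c) (hbc : b ≠ c)
    (part : V → ι) (hw : ∀ u v : V, u ∉ terms a b c → v ∉ terms a b c → part u ≠ part v → (w s(u, v) : ℝ) = 0)
    (hkind : ∀ i, (∃ h, h ∉ terms a b c ∧ part h = i ∧ ∀ v, v ∉ terms a b c → part v = i → v = h) ∨
      ∃ X : Finset V,
        (∀ u v : V, (u = a ∨ (u ∉ terms a b c ∧ part u = i ∧ u ∈ X)) → (v = b ∨ (v ∉ terms a b c ∧ part v = i ∧ v ∉ X)) →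
          ((u ∉ terms a b c ∧ part u = i ∧ u ∈ X) ∨ (v ∉ terms a b c ∧ part v = i ∧ v ∉ X)) → (w s(u, v) : ℝ) = 0) ∨
        (∀ u v : V, (u = b ∨ (u ∉ terms a b c ∧ part u = i ∧ u ∈ X)) → (v = c ∨ (v ∉ terms a b c ∧ part v = i ∧ v ∉ X)) →
          ((u ∉ terms a b c ∧ part u = i ∧ u ∈ X) ∨ (v ∉ terms a b c ∧ part v = i ∧ v ∉ X)) → (w s(u, v) : ℝ) = 0) ∨
        (∀ u v : V, (u = a ∨ (u ∉ terms a b c ∧ part u = i ∧ u ∈ X)) → (v = c ∨ (v ∉ terms a b c ∧ part v = i ∧ v ∉ X)) →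
          ((u ∉ terms a b c ∧ part u = i ∧ u ∈ X) ∨ (v ∉ terms a b c ∧ part v = i ∧ v ∉ X)) → (w s(u, v) : ℝ) = 0)) :
    (prodBernoulli w).real (openConn a b) * (prodBernoulli w).real (openConn a b)ᶜ ≤
      (prodBernoulli w).real (openConn a b ∩ (openConn a c)ᶜ) + (prodBernoulli w).real (openConn a c ∩ (openConn a b)ᶜ) +
        (prodBernoulli w).real (openConn b c ∩ (openConn a b)ᶜ) := by
  have hK : ∀ i, let F := piecePairs a b c part i
      (prodBernoulli w).real (isoPiece F a b c ∩ isoPiece F b a c) ^ 3 ≤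
          (prodBernoulli w).real (isoPiece F c a b) ^ 2 * (prodBernoulli w).real (isoPiece F b a c) *
            (prodBernoulli w).real (isoPiece F a b c) ∧
        (prodBernoulli w).real (isoPiece F a b c ∩ isoPiece F b a c) ^ 3 ≤
          (prodBernoulli w).real (isoPiece F c a b) * (prodBernoulli w).real (isoPiece F b a c) ^ 2 *
            (prodBernoulli w).real (isoPiece F a b c) ∧
        (prodBernoulli w).real (isoPiece F a b c ∩ isoPiece F b a c) ^ 3 ≤
          (prodBernoulli w).real (isoPiece F c a b) * (prodBernoulli w).real (isoPiece F b a c) *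
            (prodBernoulli w).real (isoPiece F a b c) ^ 2 := by
    intro i
    rcases hkind i with ⟨h, hh, hhi, hi⟩ | ⟨X, hX⟩
    · exact isoK_hub w part hab hac hbc hh hhi hi
    · exact isoK_series w part i hab hac hbc X hX
  exact threePointVariance_of_pieces w hab hac hbc part hw (fun i => (hK i).1) (fun i => (hK i).2.1) (fun i => (hK i).2.2)

end Summit.CriticalPhenomena.PercolationContinuityZ3.Theorems.ThreePointPieces
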